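/-
Copyright (c) 2026. All rights reserved.
Released under Apache 2.0 license as described in the file LICENSE.
Authors: abc-iut cell, statement-typer seat abc-iut-L4-t3 (wave 1; gen 6).
-/
import Literature.AnabelianGeometry.AbsoluteAnabelian.LogFrobeniusMonoCoresNecessity
import HarnessLib

/-!
# [AbsTopIII] Corollary 5.10 (iv)(b)(c), print-faithful successor statement: the mono-analytic telecore `𝔗_{An⊢}` and its contact structure `ℋ_{An⊢}` with the telecore edge of `γ¹_{v,ν}` PINNED to `φ^{An⊢⊞}_{v,ν}`

S. Mochizuki, *Topics in absolute anabelian geometry III: global reconstruction algorithms*,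
J. Math. Sci. Univ. Tokyo 22 (2015) 939–1156 [MochizukiAbsTopIII2015]; locators `p.N` = pages of the author's
manuscript (`paper:url-5493eb38cbb7`), read on the page (own render p0147 l.54–65, p0148 l.1–51): Cor 5.10 (iv)(b)
p. 147 ("As `v` ranges over the elements of `V(F_mod)` and `ν` over the elements of `Γ⃗^×_v`, the restrictions
`φ^{An⊢⊞}_{v,ν} : An⊢[𝒩⊢⊞] → 𝒩⊢⊞_v` to `An⊢[𝒩⊢⊞]` of the 'forgetful functors' `ψ^{An⊢⊞}_{v,ν}` of Proposition 5.8, (vii),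
give rise to a telecore structure `𝔗_{An⊢}` on `D•⊢_{≤5} ∪ D•_{≤6}`, whose underlying diagram of categories we denote by
`D_{An⊢}`, by appending to `D•⊢_{≤6}` telecore edges corresponding to the arrows `φ^{An⊢⊞}_{v,ν}` from the core
`An⊢[𝒩⊢⊞]` to the vertices of the row of `D⊢` indexed by the integer 3"), (iv)(c) p. 148 ("For `v ∈ V(F_mod)`,
`ν ∈ Γ⃗^×_v`, there is a natural isomorphism `η⊢_{v,ν}` from the composite functor determined by the path `γ¹_{v,ν}` [of
length 6] `𝒳 →(λ⊞_{v,ν}) 𝒩⊞_v → 𝒩_v → ℰ• → ℰ⊢ → An⊢[𝒩⊢⊞] →(φ^{An⊢⊞}_{v,ν}) 𝒩⊢⊞_v` on `Γ⃗_{D_{An⊢}}` … to the composite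
functor determined by the path `γ⁰_{v,ν}` [of length 2] `𝒳 →(λ⊞_{v,ν}) 𝒩⊞_v → 𝒩⊢⊞_v` on `Γ⃗_{D_{An⊢}}`.  Moreover, the
resulting homotopies `η⊢_{v,ν}`, `(η⊢_{v,ν})⁻¹`, together with the mono-analyticization homotopies …, generate a contact
structure `ℋ_{An⊢}` on `𝔗_{An⊢}` …"), Def 3.5 (iv) p. 76 (telecores, contact structures).

WHY THIS FILE (v-next of FACT-LIST row F-0139; the FROZEN `LogFrobeniusCorollaries.lean` of this seat is NOT edited —
successor statement, never re-meant in place).  The typed row `LogFrobeniusSetting.Cor510MonoTelecore L` pins, in the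
contact structure `ℋ_{An⊢}`, the pair `(γ¹_{v,ν}, γ⁰_{v,ν})` in both orders — but binds the LAST arrow of `γ¹_{v,ν}` as an
ARBITRARY telecore edge `j : T.J ⟨𝒩⊢⊞_v⟩` (the identification `T.J = MonoTelecoreIdx` being an anonymous conjunct,
`⟨ν, hν⟩` could not be written there without a cast), whereas print (p. 148, quoted above) uses `φ^{An⊢⊞}_{v,ν}` with
THE SAME `ν` as `λ⊞_{v,ν}`.  abc-iut-f-101 showed in the kernel that this excess is real
(`LogFrobeniusMonoTelecoreUnpinned.lean`: the typed row identifies the mono-analyticizations of ALL the `λ⊞_{v,ν}`,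
`lamMono_iso_lamMono_of_cor510MonoTelecore`, and FAILS at a setting carrying every printed datum,
`exists_printedData_not_cor510MonoTelecore`) and asked the interface owner for the pinned restatement.  Here it is:

* `pinnedEdge hJ v hnm ν hν` — the telecore edge `φ^{An⊢⊞}_{v,ν} : An⊢[𝒩⊢⊞] → 𝒩⊢⊞_v` of a telecore `T` whose edge
  family is identified with the printed one by `hJ : T.J = MonoTelecoreIdx` (a cast along `hJ`; it COMPUTES to
  `⟨ν, hν⟩` whenever `T.J` is the printed family definitionally, `pinnedEdge_rfl` — e.g. for abc-iut-f-101's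
  `monoTelecore hN hψ`, whose `monoTelecore_J` is `rfl`);
* `Cor510MonoTelecorePinned L` — VERBATIM `Cor510MonoTelecore L` except that the conjunct `T.J = MonoTelecoreIdx` is
  the named binder `hJ` and the last arrow of `γ¹_{v,ν}` is `pinnedEdge hJ v hnm ν hν` (no quantifier over `j`);
* `cor510MonoTelecorePinned_of_cor510MonoTelecore` — the typed row implies the pinned one (instantiate `j` at the
  pinned edge): every consumer of F-0139 BY NAME keeps what it had;
* what the pinned row still FORCES (GAP-LEDGER G-f101-2, data (a), (c), (d)):
  `isCoreOn_anMono_of_cor510MonoTelecorePinned` / `toE_iso_of_cor510MonoTelecorePinned` (the rows-4→5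
  mono-analyticization homotopy, (a)), `psiOverCore_iso_of_cor510MonoTelecorePinned` ("`ψ^{An⊢⊞}_{w,ν}` lies over `ℰ⊢`",
  (c) — abc-iut-f-101's argument, which never used the contact pairs), `etaMono_iso_of_cor510MonoTelecorePinned` (the
  PRINTED `η⊢_{v,ν}`, (d), and ONLY these: the cross identifications `ν ≠ ν′` of the unpinned row are not produced, so
  abc-iut-f-101's tagged counter-model does not refute the pinned row — whether it HOLDS there is a corollary of the
  sufficiency "(a)+(c)+(d)+coherence ⇒ pinned (iv)(b)(c)" announced by abc-iut-f-101, not built here).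

All statements are parameterised by the interface `L`: ASSUMPTIONS on `L` that the text asserts for the genuine
theaters.  Refereed pre-IUT material; nothing here bears on [IUTchIII] Cor. 3.12; OUR kernel check, no side taken;
typed ≠ proved.
-/

set_option autoImplicit false

universe u

open CategoryTheory Quiver

namespace Literature.AnabelianGeometry.AbsoluteAnabelian

namespace LogFrobeniusSetting

variable {Vmod : Type u} {isArc : Vmod → Bool} (L : LogFrobeniusSetting Vmod isArc)

/-! ## The pinned telecore edge `φ^{An⊢⊞}_{v,ν}` -/

/-- The telecore edge `φ^{An⊢⊞}_{v,ν} : An⊢[𝒩⊢⊞] → 𝒩⊢⊞_v` — "telecore edges corresponding to the arrows `φ^{An⊢⊞}_{v,ν}` from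
the core `An⊢[𝒩⊢⊞]` to the vertices of the row of `D⊢` indexed by the integer 3" — of a telecore whose family of telecore
edges `J` is identified with the printed one (`MonoTelecoreIdx`: over `𝒩⊢⊞_v` the vertices `ν ∈ Γ⃗^×_v`) by `hJ`: the
element `⟨ν, hν⟩` transported along `hJ`. [cite: MochizukiAbsTopIII2015, Cor 5.10 (iv)(b) pp.147–148] -/
def pinnedEdge {J : DSub (monoBase (Vmod := Vmod) (isArc := isArc) 6) → Type u}
    (hJ : J = fun a => MonoTelecoreIdx a.1) (v : Vmod) (hnm : monoBase (isArc := isArc) 6 (.nmonoPlus v))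
    (ν : LogVertex (isArc v)) (hν : ν.IsCross) : J ⟨.nmonoPlus v, hnm⟩ :=
  cast (congrFun hJ ⟨.nmonoPlus v, hnm⟩).symm (ULift.up ⟨ν, hν⟩)

/-- When the family of telecore edges IS the printed one, the pinned edge is literally `⟨ν, hν⟩` (the cast along `rfl`
computes). [cite: MochizukiAbsTopIII2015, Cor 5.10 (iv)(b) p.147] -/
theorem pinnedEdge_rfl (v : Vmod) (hnm : monoBase (isArc := isArc) 6 (.nmonoPlus v)) (ν : LogVertex (isArc v))
    (hν : ν.IsCross) :
    pinnedEdge (Vmod := Vmod) (isArc := isArc) rfl v hnm ν hν = ULift.up ⟨ν, hν⟩ := rfl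

/-- The pinned edge does not depend on the proof `hJ` (proof irrelevance; bookkeeping for consumers who obtain `hJ` by
a different route). [cite: MochizukiAbsTopIII2015, Cor 5.10 (iv)(b) p.147] -/
theorem pinnedEdge_congr {J : DSub (monoBase (Vmod := Vmod) (isArc := isArc) 6) → Type u}
    (hJ hJ' : J = fun a => MonoTelecoreIdx a.1) (v : Vmod) (hnm : monoBase (isArc := isArc) 6 (.nmonoPlus v))
    (ν : LogVertex (isArc v)) (hν : ν.IsCross) :
    pinnedEdge hJ v hnm ν hν = pinnedEdge hJ' v hnm ν hν := rfl

/-! ## Corollary 5.10 (iv)(b), (c) with the pinned telecore edge -/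

/-- **Cor 5.10 (iv)(b)(c), print-faithful successor of `Cor510MonoTelecore`** (Mono-analytic Telecores and Contact
Structures): the restrictions `φ^{An⊢⊞}_{v,ν}` of the forgetful functors `ψ^{An⊢⊞}_{v,ν}` give a telecore structure `𝔗_{An⊢}`
over the mono-analytic core with core vertex `An⊢[𝒩⊢⊞]` (Cor 5.10 (iv)(a), `n = 6`) by appending telecore edges from the
core to row 3 of `D⊢` (`hJ`: the telecore edges ARE the `φ^{An⊢⊞}_{v,ν}`, `v ∈ V(F_mod)`, `ν ∈ Γ⃗^×_v`, with these functors);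
and a contact structure `ℋ_{An⊢}` on it in which, for each `v`, `ν ∈ Γ⃗^×_v`, the length-6 path
`γ¹_{v,ν} = □ →(λ⊞_{v,ν}) 𝒩⊞_v → 𝒩_v → ℰ• → ℰ⊢ → An⊢[𝒩⊢⊞] →(φ^{An⊢⊞}_{v,ν}) 𝒩⊢⊞_v` — last arrow the telecore edge with THE
SAME `ν` (`pinnedEdge`) — and the length-2 path `γ⁰_{v,ν} = □ →(λ⊞_{v,ν}) 𝒩⊞_v → 𝒩⊢⊞_v` form a boundary pair in both orders
(so their homotopy `η⊢_{v,ν}` is an isomorphism).  ONE change from the frozen `Cor510MonoTelecore` (which binds the last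
arrow as an arbitrary telecore edge `j`): nothing else is re-meant.  (The compatibility with `𝔗_{An•}`, `ℋ_{An•}`, `S_log`,
`S_log⊞` — TODO(general form), as there.) [cite: MochizukiAbsTopIII2015, Cor 5.10 (iv)(b)(c) pp. 147–148] -/
def Cor510MonoTelecorePinned : Prop :=
  ∃ (H : ((L.subdiagram (monoBase (isArc := isArc) 6)).extend (L.obsExt (monoBase 6) .anMono)).HomotopyFamily)
    (hH : ∀ ⦃a b : (obsShape (monoBase (isArc := isArc) 6) DVertex.anMono).Vertex⦄ ⦃p q : Path a b⦄,
      H.E p q → b = (obsShape (monoBase (isArc := isArc) 6) DVertex.anMono).obs)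
    (hc : (DiagramOfCategories.Observable.mk _ (fun _ => (inferInstance : IsEmpty PEmpty.{u + 1})) _ H hH).IsCore)
    (T : DiagramOfCategories.Telecore _ _ hc)
    (hJ : T.J = (fun a => MonoTelecoreIdx a.1)),
    HEq (fun (a : DSub (monoBase (isArc := isArc) 6)) (j : T.J a) => T.telMap j)
        (fun (a : DSub (monoBase (isArc := isArc) 6)) (j : MonoTelecoreIdx a.1) => L.monoTelecoreFun a.1 j) ∧
      ∃ Hc : ((L.subdiagram (monoBase (isArc := isArc) 6)).extend
          (X := ⟨(obsShape (monoBase (isArc := isArc) 6) DVertex.anMono).I, T.J⟩)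
          ⟨L.AnMono, fun e => DEdge.functor L e, T.telMap⟩).HomotopyFamily,
        DiagramOfCategories.Telecore.IsContactStructure _ T Hc ∧
        ∀ (v : Vmod) (ν : LogVertex (isArc v)) (hν : ν.IsCross)
          (hcore : monoBase (isArc := isArc) 6 .core) (hnp : monoBase (isArc := isArc) 6 (.nplus v))
          (hnv : monoBase (isArc := isArc) 6 (.nv v)) (he5 : monoBase (isArc := isArc) 6 .e5)
          (hem : monoBase (isArc := isArc) 6 .emono5) (hnm : monoBase (isArc := isArc) 6 (.nmonoPlus v)),
          let X' : ExtShape.{u} (DSub (monoBase (isArc := isArc) 6)) :=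
            ⟨(obsShape (monoBase (isArc := isArc) 6) DVertex.anMono).I, T.J⟩
          let γ₁ : Path (X'.base ⟨.core, hcore⟩) (X'.base ⟨.nmonoPlus v, hnm⟩) :=
            ((((((Path.nil.cons (show X'.base ⟨.core, hcore⟩ ⟶ X'.base ⟨.nplus v, hnp⟩ from DEdge.lam v ν hν.1)).cons
              (show X'.base ⟨.nplus v, hnp⟩ ⟶ X'.base ⟨.nv v, hnv⟩ from DEdge.forget v)).cons
              (show X'.base ⟨.nv v, hnv⟩ ⟶ X'.base ⟨.e5, he5⟩ from DEdge.toE v)).cons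
              (show X'.base ⟨.e5, he5⟩ ⟶ X'.base ⟨.emono5, hem⟩ from DEdge.monoE5)).cons
              (show X'.base ⟨.emono5, hem⟩ ⟶ X'.obs from DEdge.κAnMono)).cons
              (show X'.obs ⟶ X'.base ⟨.nmonoPlus v, hnm⟩ from pinnedEdge hJ v hnm ν hν))
          let γ₀ : Path (X'.base ⟨.core, hcore⟩) (X'.base ⟨.nmonoPlus v, hnm⟩) :=
            ((Path.nil.cons (show X'.base ⟨.core, hcore⟩ ⟶ X'.base ⟨.nplus v, hnp⟩ from DEdge.lam v ν hν.1)).cons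
              (show X'.base ⟨.nplus v, hnp⟩ ⟶ X'.base ⟨.nmonoPlus v, hnm⟩ from DEdge.monoNplus v))
          Hc.E γ₁ γ₀ ∧ Hc.E γ₀ γ₁

/-! ## The typed row implies the pinned row -/

/-- **`Cor510MonoTelecore L → Cor510MonoTelecorePinned L`**: the frozen row F-0139 pins the pair `(γ¹, γ⁰)` for EVERY
telecore edge `j` into `𝒩⊢⊞_v`, in particular for the printed one `j := φ^{An⊢⊞}_{v,ν}` (`pinnedEdge`).  (The converse fails
in general: abc-iut-f-101's tagged setting, `LogFrobeniusMonoTelecoreUnpinned.lean`.)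
[cite: MochizukiAbsTopIII2015, Cor 5.10 (iv)(b)(c) pp. 147–148] -/
theorem cor510MonoTelecorePinned_of_cor510MonoTelecore (h : L.Cor510MonoTelecore) : L.Cor510MonoTelecorePinned := by
  obtain ⟨H, hH, hc, T, hJ, hT, Hc, hcs, hpairs⟩ := h
  exact ⟨H, hH, hc, T, hJ, hT, Hc, hcs, fun v ν hν hcore hnp hnv he5 hem hnm =>
    hpairs v ν hν hcore hnp hnv he5 hem hnm (pinnedEdge hJ v hnm ν hν)⟩

/-! ## What the pinned row forces: the data (a), (c), (d) of GAP-LEDGER G-f101-2 -/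

/-- The core clause: `An⊢[𝒩⊢⊞]` is a core of `D•⊢_{≤5} ∪ D•_{≤6}` (the `n = 6` clause of Cor 5.10 (iv)(a), this seat's
`IsCoreOn`). [cite: MochizukiAbsTopIII2015, Cor 5.10 (iv)(a) p.147] -/
theorem isCoreOn_anMono_of_cor510MonoTelecorePinned (h : L.Cor510MonoTelecorePinned) :
    L.IsCoreOn (monoBase 6) .anMono := by
  obtain ⟨H, hH, hc, -⟩ := h
  exact ⟨H, hH, hc⟩

/-- **(a) is necessary**: the pinned row yields the rows-4→5 mono-analyticization homotopy
`𝒩_v → 𝒩⊢_v → ℰ⊢ ≅ 𝒩_v → ℰ• → ℰ⊢` at every `v` (abc-iut-f-101's `toE_iso_of_isCoreOn_anMono` on the core clause; Def 5.6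
(iv), Cor 5.10 preamble "mono-analyticization homotopies"). [cite: MochizukiAbsTopIII2015, Cor 5.10 (iv)(b) p.147] -/
theorem toE_iso_of_cor510MonoTelecorePinned (h : L.Cor510MonoTelecorePinned) (v : Vmod) :
    Nonempty (L.monoN v ⋙ L.toEmono v ≅ L.toE v ⋙ L.monoAn) :=
  L.toE_iso_of_isCoreOn_anMono (L.isCoreOn_anMono_of_cor510MonoTelecorePinned h) v

/-- **(d) is necessary — the PRINTED `η⊢_{v,ν}`**: the pinned row yields, for every `v` and every `ν ∈ Γ⃗^×_v`, an
isomorphism between the functors of `γ¹_{v,ν} = □ → 𝒩⊞_v → 𝒩_v → ℰ• → ℰ⊢ → An⊢[𝒩⊢⊞] →(φ^{An⊢⊞}_{v,ν}) 𝒩⊢⊞_v` and of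
`γ⁰_{v,ν} = □ → 𝒩⊞_v → 𝒩⊢⊞_v` — the contact structure contains the pair in both orders, and such a pair carries an
isomorphism (`HomotopyFamily.isIso_of_mem_mem`).  Same `ν` on both telecore-side and `λ⊞`-side, as in print; the cross
identifications `ν ≠ ν′` of the unpinned row (`etaMonoAt_iso_of_cor510MonoTelecore`) are NOT available here.
[cite: MochizukiAbsTopIII2015, Cor 5.10 (iv)(c) p.148] -/
theorem etaMono_iso_of_cor510MonoTelecorePinned (h : L.Cor510MonoTelecorePinned) (v : Vmod) (ν : LogVertex (isArc v))
    (hν : ν.IsCross) :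
    Nonempty (L.lam v ν ⋙ L.forget v ⋙ L.toE v ⋙ L.monoAn ⋙ L.κAnMono.functor ⋙ L.ψAnMono v ⟨ν, hν⟩ ≅
      L.lam v ν ⋙ L.monoNplus v) := by
  obtain ⟨H, hH, hc, T, hJ, hT, Hc, -, hpairs⟩ := h
  obtain ⟨J, telMap, Jfam, hb, hpi, hrE, hrη⟩ := T
  change J = fun a => MonoTelecoreIdx a.1 at hJ
  subst hJ
  change HEq (fun (a : DSub (monoBase (isArc := isArc) 6)) (j : MonoTelecoreIdx a.1) => telMap j)
    (fun (a : DSub (monoBase (isArc := isArc) 6)) (j : MonoTelecoreIdx a.1) => L.monoTelecoreFun a.1 j) at hT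
  have hT' : ∀ (a : DSub (monoBase (isArc := isArc) 6)) (j : MonoTelecoreIdx a.1), telMap j = L.monoTelecoreFun a.1 j :=
    fun a j => congrFun (congrFun (eq_of_heq hT) a) j
  obtain ⟨h₁₀, h₀₁⟩ := hpairs v ν hν monoBase_six_core (monoBase_six_nplus v) (monoBase_six_nv v) monoBase_six_e5
    monoBase_six_emono5 (monoBase_six_nmonoPlus v)
  have hi : IsIso (Hc.η h₁₀) := Hc.isIso_of_mem_mem h₁₀ h₀₁
  refine ⟨eqToIso ?_ ≪≫ @asIso _ _ _ _ (Hc.η h₁₀) hi ≪≫ eqToIso ?_⟩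
  · rw [DiagramOfCategories.pathFunctor_cons, DiagramOfCategories.pathFunctor_cons,
      DiagramOfCategories.pathFunctor_cons, DiagramOfCategories.pathFunctor_cons,
      DiagramOfCategories.pathFunctor_cons, DiagramOfCategories.pathFunctor_cons, DiagramOfCategories.pathFunctor_nil]
    change _ = (((((𝟭 _ ⋙ L.lam v ν) ⋙ L.forget v) ⋙ L.toE v) ⋙ L.monoAn) ⋙ L.κAnMono.functor) ⋙
      telMap (a := ⟨.nmonoPlus v, monoBase_six_nmonoPlus v⟩)
        (show MonoTelecoreIdx (DVertex.nmonoPlus (isArc := isArc) v) from ULift.up ⟨ν, hν⟩)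
    rw [hT' ⟨.nmonoPlus v, monoBase_six_nmonoPlus v⟩
      (show MonoTelecoreIdx (DVertex.nmonoPlus (isArc := isArc) v) from ULift.up ⟨ν, hν⟩)]
    rfl
  · rw [DiagramOfCategories.pathFunctor_cons, DiagramOfCategories.pathFunctor_cons, DiagramOfCategories.pathFunctor_nil]
    rfl

/-- **(c) is necessary — "`ψ^{An⊢⊞}_{w,ν}` lies over `ℰ⊢`"**: the pinned row yields, for every `w` and every `ν ∈ Γ⃗^×_w`,
`ψ^{An⊢⊞}_{w,ν} ⋙ (𝒩⊢⊞_w → 𝒩⊢_w → ℰ⊢) ≅ (An⊢[𝒩⊢⊞] ⥲ ℰ⊢)` (Prop 5.8 (vii): in print the `ψ` are the forgetful functors of a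
fibred product OVER `ℰ⊢`).  abc-iut-f-101's argument for the unpinned row verbatim — it uses the telecore family `𝒥` only
(the loop `ℰ⊢ ⥲ An⊢ →(φ) 𝒩⊢⊞_w → 𝒩⊢_w → ℰ⊢ ⥲ An⊢` against `ℰ⊢ ⥲ An⊢`, Def 3.5 (iv) (b)), never the contact pairs.
[cite: MochizukiAbsTopIII2015, Cor 5.10 (iv)(b) p.147] -/
theorem psiOverCore_iso_of_cor510MonoTelecorePinned (h : L.Cor510MonoTelecorePinned) (w : Vmod)
    (j : {ν : LogVertex (isArc w) // ν.IsCross}) :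
    Nonempty (L.ψAnMono w j ⋙ L.forgetMono w ⋙ L.toEmono w ≅ L.κAnMono.inverse) := by
  obtain ⟨H, hH, hc, T, hJ, hT, Hc, -, -⟩ := h
  obtain ⟨J, telMap, Jfam, hb, hpi, hrE, hrη⟩ := T
  change J = fun a => MonoTelecoreIdx a.1 at hJ
  subst hJ
  change HEq (fun (a : DSub (monoBase (isArc := isArc) 6)) (j : MonoTelecoreIdx a.1) => telMap j)
    (fun (a : DSub (monoBase (isArc := isArc) 6)) (j : MonoTelecoreIdx a.1) => L.monoTelecoreFun a.1 j) at hT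
  have hT' : ∀ (a : DSub (monoBase (isArc := isArc) 6)) (j : MonoTelecoreIdx a.1), telMap j = L.monoTelecoreFun a.1 j :=
    fun a j => congrFun (congrFun (eq_of_heq hT) a) j
  let X' : ExtShape.{u} (DSub (monoBase (isArc := isArc) 6)) :=
    ⟨(obsShape (monoBase (isArc := isArc) 6) DVertex.anMono).I, fun a => MonoTelecoreIdx a.1⟩
  -- the length-5 loop `ℰ⊢ ⥲ An⊢ →(φ_{w,ν}) 𝒩⊢⊞_w → 𝒩⊢_w → ℰ⊢ ⥲ An⊢` and the edge `ℰ⊢ ⥲ An⊢`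
  let P : Path (X'.base ⟨.emono5, monoBase_six_emono5⟩) X'.obs :=
    ((((Path.nil.cons (show X'.base ⟨.emono5, monoBase_six_emono5⟩ ⟶ X'.obs from DEdge.κAnMono)).cons
      (show X'.obs ⟶ X'.base ⟨.nmonoPlus w, monoBase_six_nmonoPlus w⟩ from
        (ULift.up j : MonoTelecoreIdx (DVertex.nmonoPlus (isArc := isArc) w)))).cons
      (show X'.base ⟨.nmonoPlus w, monoBase_six_nmonoPlus w⟩ ⟶ X'.base ⟨.nmono w, monoBase_six_nmono w⟩ from
        DEdge.forgetMono w)).cons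
      (show X'.base ⟨.nmono w, monoBase_six_nmono w⟩ ⟶ X'.base ⟨.emono5, monoBase_six_emono5⟩ from
        DEdge.toEmono w)).cons
      (show X'.base ⟨.emono5, monoBase_six_emono5⟩ ⟶ X'.obs from DEdge.κAnMono)
  let Q : Path (X'.base ⟨.emono5, monoBase_six_emono5⟩) X'.obs :=
    Path.nil.cons (show X'.base ⟨.emono5, monoBase_six_emono5⟩ ⟶ X'.obs from DEdge.κAnMono)
  have hPQ : Jfam.E P Q := (hb P Q).mpr ⟨P, Q, Path.nil, rfl, rfl⟩
  have hQP : Jfam.E Q P := (hb Q P).mpr ⟨Q, P, Path.nil, rfl, rfl⟩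
  have hi : IsIso (Jfam.η hPQ) := Jfam.isIso_of_mem_mem hPQ hQP
  have I : (L.κAnMono.functor ⋙ L.ψAnMono w j) ⋙ L.forgetMono w ⋙ L.toEmono w ⋙ L.κAnMono.functor ≅
      L.κAnMono.functor := by
    refine eqToIso ?_ ≪≫ @asIso _ _ _ _ (Jfam.η hPQ) hi ≪≫ eqToIso ?_
    · rw [DiagramOfCategories.pathFunctor_cons, DiagramOfCategories.pathFunctor_cons,
        DiagramOfCategories.pathFunctor_cons, DiagramOfCategories.pathFunctor_cons,
        DiagramOfCategories.pathFunctor_cons, DiagramOfCategories.pathFunctor_nil]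
      change _ = ((((𝟭 _ ⋙ L.κAnMono.functor) ⋙
        telMap (a := ⟨.nmonoPlus w, monoBase_six_nmonoPlus w⟩)
          (show MonoTelecoreIdx (DVertex.nmonoPlus (isArc := isArc) w) from ULift.up j)) ⋙
            L.forgetMono w) ⋙ L.toEmono w) ⋙ L.κAnMono.functor
      rw [hT' ⟨.nmonoPlus w, monoBase_six_nmonoPlus w⟩
        (show MonoTelecoreIdx (DVertex.nmonoPlus (isArc := isArc) w) from ULift.up j)]
      rfl
    · rw [DiagramOfCategories.pathFunctor_cons, DiagramOfCategories.pathFunctor_nil]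
      rfl
  -- cancel the equivalence `ℰ⊢ ≃ An⊢[𝒩⊢⊞]` on both sides
  let Ψ := L.ψAnMono w j ⋙ L.forgetMono w ⋙ L.toEmono w
  have I₁ : L.κAnMono.functor ⋙ Ψ ⋙ L.κAnMono.functor ≅ L.κAnMono.functor :=
    (Functor.associator _ _ _).symm ≪≫ I
  have I₂ : Ψ ⋙ L.κAnMono.functor ≅ 𝟭 _ :=
    (Functor.leftUnitor _).symm ≪≫ Functor.isoWhiskerRight L.κAnMono.counitIso.symm (Ψ ⋙ L.κAnMono.functor) ≪≫
      Functor.associator _ _ _ ≪≫ Functor.isoWhiskerLeft L.κAnMono.inverse I₁ ≪≫ L.κAnMono.counitIso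
  exact ⟨(Functor.rightUnitor _).symm ≪≫ Functor.isoWhiskerLeft Ψ L.κAnMono.unitIso ≪≫
    (Functor.associator _ _ _).symm ≪≫ Functor.isoWhiskerRight I₂ L.κAnMono.inverse ≪≫ Functor.leftUnitor _⟩

/-- Summary of the necessary data: the pinned row yields `V(F_mod)`-indexed families of (a) the rows-4→5
mono-analyticization homotopies, (c) the over-`ℰ⊢` isomorphisms of the `ψ^{An⊢⊞}_{w,ν}`, (d) the printed `η⊢_{v,ν}` —
exactly the data abc-iut-f-101's tagged setting carries (`exists_printedData_not_cor510MonoTelecore`), at which the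
UNPINNED row fails. [cite: MochizukiAbsTopIII2015, Cor 5.10 (iv)(b)(c) pp. 147–148] -/
theorem printedData_of_cor510MonoTelecorePinned (h : L.Cor510MonoTelecorePinned) :
    (∀ v : Vmod, Nonempty (L.monoN v ⋙ L.toEmono v ≅ L.toE v ⋙ L.monoAn)) ∧
    (∀ (w : Vmod) (j : {ν : LogVertex (isArc w) // ν.IsCross}),
      Nonempty (L.ψAnMono w j ⋙ L.forgetMono w ⋙ L.toEmono w ≅ L.κAnMono.inverse)) ∧
    (∀ (v : Vmod) (ν : LogVertex (isArc v)) (hν : ν.IsCross),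
      Nonempty (L.lam v ν ⋙ L.forget v ⋙ L.toE v ⋙ L.monoAn ⋙ L.κAnMono.functor ⋙ L.ψAnMono v ⟨ν, hν⟩ ≅
        L.lam v ν ⋙ L.monoNplus v)) :=
  ⟨L.toE_iso_of_cor510MonoTelecorePinned h, L.psiOverCore_iso_of_cor510MonoTelecorePinned h,
    L.etaMono_iso_of_cor510MonoTelecorePinned h⟩

end LogFrobeniusSetting

end Literature.AnabelianGeometry.AbsoluteAnabelian
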